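import Summits.BirchSwinnertonDyer.BirchSwinnertonDyer.Theorems.ManinLocalTwoThreeKummerDiamondIndexFourShapeNoCES
import Literature.NumberTheory.EllipticCurves.Gamma1ParametrizationCuspGaloisActionProofs
import HarnessLib

/-!
# C2 `ManinOddAtFour` — the CONDITIONAL closer of record (modulo the two printed facts {CDT, T-es-75})
(route `ManinLocalTwoThree`, crux C2 stmt-BirchSwinnertonDyer-22967; cell bsd-f2-manin, prover seat p2 gen 22)

`maninLocalTwoThree_maninOddAtFour_of_CDT_of_cuspInvGaloisAction` concludes the route decl
`Summit.BirchSwinnertonDyer.BirchSwinnertonDyer.Theses.ManinLocalTwoThree.ManinOddAtFour` BY NAME under exactly two named, statement-only, PRINTED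
Literature facts taken as hypotheses:

* `hCDT : Literature.NumberTheory.Automorphic.CalegariDimitrovTang2025_unboundedDenominators` — Calegari–Dimitrov–Tang, J. Amer. Math. Soc. 38
  (2025) Thm 1 (unbounded denominators), holomorphic-at-the-cusps special case;
* `hSt : Literature.NumberTheory.EllipticCurves.ModularForms.optimalGamma1Parametrization_cuspInv_galoisAction` — Stevens 1982 Thm 1.3.1 (b)
  (Galois action `[1;y] ↦ [1;d′y]` on the cusps of `X₁(N)`, for the optimal `X₁(N)`-parametrisation; T-es-75).

It is the composition `KummerDiamondIndexFourNoCES.maninOddAtFour_of_CDT_Tes75` (p2 gen 22, p763417): CDT ⟹ `Λ₁(f) ⊆ Λ_W` ⟹ `c₀ ∣ 2` at `4 ∣ N`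
and `|c₀| = 2` forces the index-`4` configuration (an/p2/p3 `CDivision*`); there the rational `2`-torsion is a kernel theorem (p3), the flat
`X₁(N)`-datum on `W₀` (p2 `FlatGamma1Datum`) turns T-es-75 into THEOREM K, and the kummer_diamond assembly (es/LEAD/p2: halving cocycles,
Kummer subgroup, PROPOSITION A, descent dictionary, Legendre cases) yields `2⁵ ∣ N ∧ HasFreyTwistShape W₀`, contradicted by E-es-186♭ (p2, Tate).

HONEST FRAMING.  This is a CONDITIONAL result (the gate records `conditional-result`); the item's own signature is NOT proved, because the two
facts are undischarged `def … : Prop` hypotheses (each a Literature programme).  The route binders Mazur / Abbes–Ullmo / Česnavičius are unused by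
this proof; modularity (`exists_isNewformOf`) is used.  BSD is not proved; Manin's conjecture is not proved; C2 stays OPEN as filed.
[cite: CalegariDimitrovTang2025, Thm. 1] [cite: Stevens1982, §1.3 Thm. 1.3.1 (b)]
-/

set_option autoImplicit false
-- lint-debt: the directory name repeats the summit name (sibling precedent `ManinLocalTwoThreeKummerDiamondIndexFourShape.lean`)
set_option linter.dupNamespace false

namespace Summit.BirchSwinnertonDyer.BirchSwinnertonDyer.Theorems

/-- **C2 `ManinOddAtFour` modulo {CDT, T-es-75}** (CONDITIONAL closer; the two hypotheses are printed, statement-only Literature facts; nothing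
else is assumed).  [cite: CalegariDimitrovTang2025, Thm. 1] [cite: Stevens1982, §1.3 Thm. 1.3.1 (b)] -/
theorem maninLocalTwoThree_maninOddAtFour_of_CDT_of_cuspInvGaloisAction
    (hCDT : Literature.NumberTheory.Automorphic.CalegariDimitrovTang2025_unboundedDenominators)
    (hSt : Literature.NumberTheory.EllipticCurves.ModularForms.optimalGamma1Parametrization_cuspInv_galoisAction) :
    Summit.BirchSwinnertonDyer.BirchSwinnertonDyer.Theses.ManinLocalTwoThree.ManinOddAtFour :=
  ManinLocalTwoThree.KummerDiamondIndexFourNoCES.maninOddAtFour_of_CDT_Tes75 hCDT hSt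

/-- **C2 `ManinOddAtFour` modulo {CDT, T-es-75♭}** — the same closer with Stevens 1982 Thm 1.3.1 (a)+(b) in its printed CYCLOTOMIC form
`optimalGamma1Parametrization_cuspInv_cyclotomic_galois` (T-es-75♭: `τ_d ∈ Gal(ℚ(ζ_N)/ℚ)` acting on a `ℚ(ζ_N)`-rational cusp value), via the tree
theorem T-es-75♭ ⟹ T-es-75 (`optimalGamma1Parametrization_cuspInv_galoisAction_of_cyclotomic`, -ty p761747).  CONDITIONAL; offered so that the
planner's ROUTE EDIT 3 may bind either rendering of the one printed theorem.  (APPEND, p2 gen 22.)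
[cite: CalegariDimitrovTang2025, Thm. 1] [cite: Stevens1982, §1.3 Thm. 1.3.1 (a), (b)] -/
theorem maninLocalTwoThree_maninOddAtFour_of_CDT_of_cuspInvCyclotomicGalois
    (hCDT : Literature.NumberTheory.Automorphic.CalegariDimitrovTang2025_unboundedDenominators)
    (hSt : Literature.NumberTheory.EllipticCurves.ModularForms.optimalGamma1Parametrization_cuspInv_cyclotomic_galois) :
    Summit.BirchSwinnertonDyer.BirchSwinnertonDyer.Theses.ManinLocalTwoThree.ManinOddAtFour :=
  maninLocalTwoThree_maninOddAtFour_of_CDT_of_cuspInvGaloisAction hCDT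
    (Literature.NumberTheory.EllipticCurves.ModularForms.optimalGamma1Parametrization_cuspInv_galoisAction_of_cyclotomic hSt)

end Summit.BirchSwinnertonDyer.BirchSwinnertonDyer.Theorems
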